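import Summits.QuantumFields.BalabanUV.Beta.GAN24.StackedConstraintLetters

/-!
# `BalabanUV.Beta.GAN24.OneStepConstraintAxialLetters` — binder row G-an2-4 ∕ (CONV-C), routes C-R6° («VALUES») × R7 («TWO CURRENCIES»), PART 178:
# THE STACKED ONE-STEP CONSTRAINT «BAŁABAN's AVERAGING + AXIAL TREE» IN THE LINEAGE's OWN WORDS — the tree bonds `(x, μ)` of an `R`-block are `rem_ν x = 0 (ν < μ) ∧ rem_μ x + 1 < R`
# (pv09's `IsTree` in `par ∕ rem` words); the corner lift of PART 168 AVOIDS them; `|(re QB)v|² ≤ R^{−d}|v|²` (Schur); hence the right-inverse letters of the stacked constraint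
# `fromRows (re QB) E_tree` and PART 169's regularised coercivity for it — from a kernel coercivity on `ker(re QB) ∩ {axial}` ((2.153)-shape) ALONE (census V200 (α)(β))
# (unit b2b-balaban-gan24-p3, gen 59; v1)

NOT IN PRINT; OUR PROOF ([folklore] bookkeeping BY NAME over PART 168 `OneStepConstraintLetters` (`reM_QB_mulVec_cornerLift`, `cornerLift_dotProduct_self`, `re_QB_nonneg`, `sum_re_QB_row`,
`sum_re_QB_col`), PART 177 `StackedConstraintLetters` (`proj_mulVec`, `proj_mulVec_ext`, `ext_dotProduct_self`, `coercive_reg_fromRows`), Mathlib's `Finset.sum_mul_sq_le_sq_mul_sq`.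
[Balaban1984PropagatorsII] (2.121) p. 244 («B(Γ_{y,x}) = 0 for x ∈ B(y)» — the axial tree), (2.153) p. 249 LOCATE the objects; pv09's `B6BondElimination.IsTree L Y p` = «corner ∈ Y ∧ p_μ + 1 <
corner_μ + L ∧ ∀ i < μ, p_i = corner_i» is the box-coordinate form of §1's predicate.  Nothing printed is a hypothesis.)
HONEST FRAMING (cell contract, verbatim): «discharging `BetaPertH` makes Bałaban's UV stability UNCONDITIONAL — a real constructive-QFT result; it is NOT the continuum limit
and NOT the Clay problem.»  HONEST DEPENDENCY (verbatim): «continuum YM on T⁴ ⇐ BetaPertH ∧ nine spine estimates (0/9 proved); BetaPertH ⇐ (D1) ∧ (D4) ∧ CAP+tail; G-an2-4 gates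
asym, D1 and NE2/3/4.»

WHY (census V200, gen 59).  The repair of census V195 ∕ V196 is the STACKED constraint `fromRows Q̃ E` (PART 177): Bałaban's averaging `Q̃ = re QB` AND the coordinate projection `E` onto the
axial tree bonds.  PART 177 reduced its letters to block letters; THIS FILE supplies the `QB`-specific ones in the lineage's `par ∕ rem` vocabulary, so that PART 169 ∕ 170-type ENDs for the
gauge-fixed one-loop letter need exactly ONE more input: the kernel coercivity on `ker(re QB) ∩ {axial}` — (2.153), a tree theorem for `Σ_k` in pv09's currency (PART 176
`lower2153_effForm`), whose transport to this file's tree predicate is the adapter's remaining dictionary.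

WHAT THIS FILE PROVES (0 sorry, 0 `def`; `N, R ≥ 1`, every torus `M`, every `d`; the tree predicate is spelled inline as
`(∀ ν, ν < x.2 → (rem x.1 ν : ℕ) = 0) ∧ (rem x.1 x.2 : ℕ) + 1 < R`, the tree bonds as the subtype `T`, `E = proj (Embedding.subtype _)`):
* §1 **`cornerLift_apply_of_tree`** (the corner lift vanishes on every tree bond: `rem_μ x + 1 < R` excludes the top corner), **`proj_tree_mulVec_cornerLift`** (`E·(corner lift) = 0`).
* §2 **`dotProduct_reM_QB_mulVec_le`** — `|(re QB)v|² ≤ R^{−d}·|v|²` (rows of mass `1`, columns of mass `R^{−d}`, entries `≥ 0`: weighted Cauchy–Schwarz), `dotProduct_reM_QB_ext_le`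
  (`|(re QB)(ext w)|² ≤ R^{−d}|w|²`).
* §3 **`coercive_reg_QB_axial`** — for `H` symmetric with `0 ≤ ⟨u,Hu⟩ ≤ h|u|²` and `γ₀`-coercive on `ker(re QB) ∩ {u = 0 on the tree bonds}` ((2.153)-shape, the ONLY model input), and
  `a > 0`: `QGQInverse.Coercive (H + Q_axᵀ(a•1)Q_ax) (max (4∕γ₀) ((4h·e₂∕γ₀ + 2e₂)∕a))⁻¹` for the stacked constraint `Q_ax = fromRows (re QB) E`, with
  `e₂ = 4R^{2d}(1 + R^{−d}) + 2` — PART 169's `coercive_reg_QB` with the axial gauge added.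
WHAT IT IS NOT: the (2.153) input itself is NOT discharged here (PART 176 has it in pv09's currency; the dictionary `IsTree … (idxEquiv p)` ↔ §1's predicate and `QvOp L M′` ↔ `QB 1 L M′`
is census V200 (γ)); PART 105's pseudo-distance ∕ `SumBound` letters on the stacked index `(coarse bonds) ⊕ T` (both keyed by the block parent) are left to the PART 170-type consumer.
SUPPLIER work; NEVER «G-an2-4 closed»; NOT (CONV-C), NOT D1, NOT `BetaPertH`, NOT continuum, NOT Clay.  Records: `HOME/b2b-balaban-gan24-p3/gen59/README.md`.
-/

noncomputable section

open scoped BigOperators Matrix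
open Finset Matrix

namespace Summit.QuantumFields.BalabanUV.Beta.GAN24.OneStepConstraintAxialLetters

open Literature.MathematicalPhysics.QuantumFieldTheory.Balaban1983to89
open Literature.MathematicalPhysics.QuantumFieldTheory.Balaban1983to89.B5Prop11Plancherel (Tor fine)
open Literature.MathematicalPhysics.QuantumFieldTheory.Balaban1983to89.B5RealFields (reM reM_apply)
open Summit.QuantumFields.BalabanUV.T4Continuum.BalabanLineAverage (QB)
open Summit.QuantumFields.BalabanUV.T4Continuum.BalabanAveragedTowerModes (par rem)
open Summit.QuantumFields.BalabanUV.Beta.GAN24.OneStepConstraintLetters (reM_QB_mulVec_cornerLift cornerLift_dotProduct_self re_QB_nonneg sum_re_QB_row sum_re_QB_col)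
open Summit.QuantumFields.BalabanUV.Beta.GAN24.StackedConstraintLetters (proj_mulVec proj_mulVec_ext ext_dotProduct_self coercive_reg_fromRows)

variable {d : ℕ} (N R : ℕ) [NeZero N] [NeZero R] (M : Fin d → ℕ) [hM : ∀ μ, NeZero (M μ)]

/-! ## §1 The corner lift avoids the axial tree -/

section Tree

omit [NeZero N] hM in
/-- **`cornerLift_apply_of_tree`**: on a tree bond `(x, μ)` (`rem_μ x + 1 < R`) the corner lift of PART 168 vanishes — its support is the top corner `rem ≡ R − 1`. [folklore] -/
theorem cornerLift_apply_of_tree (B : Tor (fine N M) × Fin d → ℝ) (x : Tor (fine (R * N) M) × Fin d)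
    (hx : (∀ ν, ν < x.2 → ((rem N R M x.1 ν : ℕ)) = 0) ∧ ((rem N R M x.1 x.2 : ℕ)) + 1 < R) :
    (fun x : Tor (fine (R * N) M) × Fin d => if (∀ ν, ((rem N R M x.1 ν : ℕ)) = R - 1) then (R : ℝ) ^ d * B (par N R M x.1, x.2) else 0) x = 0 := by
  have hne : ¬ (∀ ν, ((rem N R M x.1 ν : ℕ)) = R - 1) := by
    intro h
    have h1 := h x.2
    have h2 := hx.2
    omega
  exact if_neg hne

/-- **`proj_tree_mulVec_cornerLift`** — `E·(corner lift B) = 0` for the coordinate projection `E` onto the tree bonds (PART 177's letter `hER`). [folklore] -/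
theorem proj_tree_mulVec_cornerLift (B : Tor (fine N M) × Fin d → ℝ) :
    ((fun (t : {x : Tor (fine (R * N) M) × Fin d // (∀ ν, ν < x.2 → ((rem N R M x.1 ν : ℕ)) = 0) ∧ ((rem N R M x.1 x.2 : ℕ)) + 1 < R})
        (x : Tor (fine (R * N) M) × Fin d) => if x = (Function.Embedding.subtype _ t) then (1 : ℝ) else 0) *ᵥ
      (fun x : Tor (fine (R * N) M) × Fin d => if (∀ ν, ((rem N R M x.1 ν : ℕ)) = R - 1) then (R : ℝ) ^ d * B (par N R M x.1, x.2) else 0)) = 0 := by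
  funext t
  rw [proj_mulVec, Pi.zero_apply]
  exact cornerLift_apply_of_tree N R M B t.1 t.2

end Tree

/-! ## §2 `|(re QB)v|² ≤ R^{−d}|v|²` -/

section Schur

/-- **`dotProduct_reM_QB_mulVec_le` — THE SCHUR BOUND FOR BAŁABAN's AVERAGING**: `|(re QB)v|² ≤ R^{−d}·|v|²` (entries `≥ 0`, row mass `1`, column mass `R^{−d}`; weighted
Cauchy–Schwarz row by row). [folklore] -/
theorem dotProduct_reM_QB_mulVec_le (v : Tor (fine (R * N) M) × Fin d → ℝ) :
    (reM (QB N R M) *ᵥ v) ⬝ᵥ (reM (QB N R M) *ᵥ v) ≤ ((R : ℝ) ^ d)⁻¹ * (v ⬝ᵥ v) := by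
  -- row by row: `(Σ_x q_{ix} v_x)² ≤ (Σ_x q_{ix})(Σ_x q_{ix} v_x²) = Σ_x q_{ix} v_x²`
  have hrow : ∀ i : Tor (fine N M) × Fin d, (reM (QB N R M) *ᵥ v) i * (reM (QB N R M) *ᵥ v) i ≤ ∑ x, (QB N R M i x).re * (v x * v x) := by
    intro i
    have hcs := Finset.sum_mul_sq_le_sq_mul_sq Finset.univ (fun x => Real.sqrt ((QB N R M i x).re)) (fun x => Real.sqrt ((QB N R M i x).re) * v x)
    have e1 : ∀ x, Real.sqrt ((QB N R M i x).re) * (Real.sqrt ((QB N R M i x).re) * v x) = (QB N R M i x).re * v x := by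
      intro x; rw [← mul_assoc, Real.mul_self_sqrt (re_QB_nonneg N R M i x)]
    have e2 : ∀ x, Real.sqrt ((QB N R M i x).re) ^ 2 = (QB N R M i x).re := fun x => Real.sq_sqrt (re_QB_nonneg N R M i x)
    have e3 : ∀ x, (Real.sqrt ((QB N R M i x).re) * v x) ^ 2 = (QB N R M i x).re * (v x * v x) := by
      intro x; rw [mul_pow, Real.sq_sqrt (re_QB_nonneg N R M i x)]; ring
    simp only [e1, e2, e3, sum_re_QB_row, one_mul] at hcs
    have e4 : (reM (QB N R M) *ᵥ v) i = ∑ x, (QB N R M i x).re * v x := by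
      simp only [Matrix.mulVec, dotProduct, reM_apply]
    rw [e4, ← sq]
    exact hcs
  calc (reM (QB N R M) *ᵥ v) ⬝ᵥ (reM (QB N R M) *ᵥ v)
      = ∑ i, (reM (QB N R M) *ᵥ v) i * (reM (QB N R M) *ᵥ v) i := rfl
    _ ≤ ∑ i, ∑ x, (QB N R M i x).re * (v x * v x) := Finset.sum_le_sum fun i _ => hrow i
    _ = ∑ x, (∑ i, (QB N R M i x).re) * (v x * v x) := by rw [Finset.sum_comm]; exact Finset.sum_congr rfl fun x _ => (Finset.sum_mul _ _ _).symm
    _ = ((R : ℝ) ^ d)⁻¹ * (v ⬝ᵥ v) := by simp only [sum_re_QB_col, ← Finset.mul_sum, dotProduct]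

/-- the same against the zero-extension of a tree datum: `|(re QB)(ext w)|² ≤ R^{−d}|w|²` (PART 177's letter `hQRE`, `q = R^{−d}`). [folklore] -/
theorem dotProduct_reM_QB_ext_le {T : Type*} [Fintype T] (ι : T ↪ Tor (fine (R * N) M) × Fin d) (w : T → ℝ) :
    (reM (QB N R M) *ᵥ (fun x => ∑ t' : T, if x = ι t' then w t' else 0)) ⬝ᵥ (reM (QB N R M) *ᵥ (fun x => ∑ t' : T, if x = ι t' then w t' else 0))
      ≤ ((R : ℝ) ^ d)⁻¹ * (w ⬝ᵥ w) := by
  rw [← ext_dotProduct_self ι w]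
  exact dotProduct_reM_QB_mulVec_le N R M _

end Schur

/-! ## §3 PART 169's regularised coercivity for «averaging + axial tree» -/

section Reg

/-- **`coercive_reg_QB_axial` — COERCIVITY OF THE STACKED REGULARISED FORM FROM (2.153)-SHAPE KERNEL COERCIVITY ALONE**: `H` symmetric, `0 ≤ ⟨u,Hu⟩ ≤ h|u|²`, and
`γ₀|z|² ≤ ⟨z,Hz⟩` whenever `(re QB)z = 0` AND `z = 0` on the tree bonds; then for `a > 0` the form `H + Q_axᵀ(a•1)Q_ax`, `Q_ax = fromRows (re QB) E_tree`, is coercive on ALL fields with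
constant `(max (4∕γ₀) ((4h·e₂∕γ₀ + 2e₂)∕a))⁻¹`, `e₂ = 4R^{2d}(1 + R^{−d}) + 2` (corner lift + zero-extension as the stacked right inverse). [folklore] -/
theorem coercive_reg_QB_axial {H : Matrix (Tor (fine (R * N) M) × Fin d) (Tor (fine (R * N) M) × Fin d) ℝ} (hH : Hᵀ = H)
    (hpsd : ∀ z, 0 ≤ z ⬝ᵥ (H *ᵥ z)) {h : ℝ} (hh : 0 ≤ h) (hHub : ∀ u, u ⬝ᵥ (H *ᵥ u) ≤ h * (u ⬝ᵥ u)) {γ₀ : ℝ} (hγ₀ : 0 < γ₀)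
    (hker : ∀ z : Tor (fine (R * N) M) × Fin d → ℝ, reM (QB N R M) *ᵥ z = 0 →
      ((fun (t : {x : Tor (fine (R * N) M) × Fin d // (∀ ν, ν < x.2 → ((rem N R M x.1 ν : ℕ)) = 0) ∧ ((rem N R M x.1 x.2 : ℕ)) + 1 < R})
          (x : Tor (fine (R * N) M) × Fin d) =>
          if x = (Function.Embedding.subtype (fun x : Tor (fine (R * N) M) × Fin d => (∀ ν, ν < x.2 → ((rem N R M x.1 ν : ℕ)) = 0) ∧ ((rem N R M x.1 x.2 : ℕ)) + 1 < R)) t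
          then (1 : ℝ) else 0) *ᵥ z = 0) →
      γ₀ * (z ⬝ᵥ z) ≤ z ⬝ᵥ (H *ᵥ z))
    {a : ℝ} (ha : 0 < a) :
    QGQInverse.Coercive
      (H + (Matrix.fromRows (reM (QB N R M))
              (fun (t : {x : Tor (fine (R * N) M) × Fin d // (∀ ν, ν < x.2 → ((rem N R M x.1 ν : ℕ)) = 0) ∧ ((rem N R M x.1 x.2 : ℕ)) + 1 < R})
                (x : Tor (fine (R * N) M) × Fin d) =>
                if x = (Function.Embedding.subtype (fun x : Tor (fine (R * N) M) × Fin d => (∀ ν, ν < x.2 → ((rem N R M x.1 ν : ℕ)) = 0) ∧ ((rem N R M x.1 x.2 : ℕ)) + 1 < R)) t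
                then (1 : ℝ) else 0))ᵀ
            * (a • (1 : Matrix ((Tor (fine N M) × Fin d) ⊕ {x : Tor (fine (R * N) M) × Fin d // (∀ ν, ν < x.2 → ((rem N R M x.1 ν : ℕ)) = 0) ∧ ((rem N R M x.1 x.2 : ℕ)) + 1 < R})
                               ((Tor (fine N M) × Fin d) ⊕ {x : Tor (fine (R * N) M) × Fin d // (∀ ν, ν < x.2 → ((rem N R M x.1 ν : ℕ)) = 0) ∧ ((rem N R M x.1 x.2 : ℕ)) + 1 < R}) ℝ))
            * Matrix.fromRows (reM (QB N R M))
              (fun (t : {x : Tor (fine (R * N) M) × Fin d // (∀ ν, ν < x.2 → ((rem N R M x.1 ν : ℕ)) = 0) ∧ ((rem N R M x.1 x.2 : ℕ)) + 1 < R})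
                (x : Tor (fine (R * N) M) × Fin d) =>
                if x = (Function.Embedding.subtype (fun x : Tor (fine (R * N) M) × Fin d => (∀ ν, ν < x.2 → ((rem N R M x.1 ν : ℕ)) = 0) ∧ ((rem N R M x.1 x.2 : ℕ)) + 1 < R)) t
                then (1 : ℝ) else 0))
      (max (4 / γ₀) ((4 * h * (4 * ((R : ℝ) ^ d) ^ 2 * (1 + ((R : ℝ) ^ d)⁻¹) + 2 * 1) / γ₀ + 2 * (4 * ((R : ℝ) ^ d) ^ 2 * (1 + ((R : ℝ) ^ d)⁻¹) + 2 * 1)) / a))⁻¹ := by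
  have hR : (0 : ℝ) < R := by exact_mod_cast Nat.pos_of_ne_zero (NeZero.ne R)
  set ι : {x : Tor (fine (R * N) M) × Fin d // (∀ ν, ν < x.2 → ((rem N R M x.1 ν : ℕ)) = 0) ∧ ((rem N R M x.1 x.2 : ℕ)) + 1 < R} ↪ Tor (fine (R * N) M) × Fin d :=
    Function.Embedding.subtype (fun x : Tor (fine (R * N) M) × Fin d => (∀ ν, ν < x.2 → ((rem N R M x.1 ν : ℕ)) = 0) ∧ ((rem N R M x.1 x.2 : ℕ)) + 1 < R) with hι
  have hQR : ∀ B : Tor (fine N M) × Fin d → ℝ, reM (QB N R M) *ᵥ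
      (fun x : Tor (fine (R * N) M) × Fin d => if (∀ ν, ((rem N R M x.1 ν : ℕ)) = R - 1) then (R : ℝ) ^ d * B (par N R M x.1, x.2) else 0) = B :=
    reM_QB_mulVec_cornerLift N R M
  have hER : ∀ B : Tor (fine N M) × Fin d → ℝ, (fun t x => if x = ι t then (1 : ℝ) else 0) *ᵥ
      (fun x : Tor (fine (R * N) M) × Fin d => if (∀ ν, ((rem N R M x.1 ν : ℕ)) = R - 1) then (R : ℝ) ^ d * B (par N R M x.1, x.2) else 0) = 0 := by
    intro B
    funext t
    rw [proj_mulVec, Pi.zero_apply, hι]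
    exact cornerLift_apply_of_tree N R M B t.1 t.2
  have hEE := proj_mulVec_ext ι
  have hRQ : ∀ B : Tor (fine N M) × Fin d → ℝ,
      (fun x : Tor (fine (R * N) M) × Fin d => if (∀ ν, ((rem N R M x.1 ν : ℕ)) = R - 1) then (R : ℝ) ^ d * B (par N R M x.1, x.2) else 0) ⬝ᵥ
      (fun x : Tor (fine (R * N) M) × Fin d => if (∀ ν, ((rem N R M x.1 ν : ℕ)) = R - 1) then (R : ℝ) ^ d * B (par N R M x.1, x.2) else 0)
        ≤ ((R : ℝ) ^ d) ^ 2 * (B ⬝ᵥ B) := fun B => (cornerLift_dotProduct_self N R M B).le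
  have hRE : ∀ w : {x : Tor (fine (R * N) M) × Fin d // (∀ ν, ν < x.2 → ((rem N R M x.1 ν : ℕ)) = 0) ∧ ((rem N R M x.1 x.2 : ℕ)) + 1 < R} → ℝ,
      (fun x => ∑ t', if x = ι t' then w t' else 0) ⬝ᵥ (fun x => ∑ t', if x = ι t' then w t' else 0) ≤ 1 * (w ⬝ᵥ w) :=
    fun w => by rw [ext_dotProduct_self, one_mul]
  have hQRE := dotProduct_reM_QB_ext_le N R M ι
  exact coercive_reg_fromRows hH hpsd hh hHub hγ₀ hker (by positivity) zero_le_one (by positivity) hQR hER hEE hRQ hRE hQRE ha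

end Reg

end Summit.QuantumFields.BalabanUV.Beta.GAN24.OneStepConstraintAxialLetters

end
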